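import Mathlib
import Literature.Barriers.ValiantsHypothesis.AlgebraicNaturalProofs
import Literature.Computability.AlgebraicComplexity.ArithCircuitProofs
import Literature.Computability.AlgebraicComplexity.ConstantFreeCircuits
import Literature.Computability.AlgebraicComplexity.ArithCircuitChain
import HarnessLib

/-!
# Separable coefficient tensors at exponent 3, I (engine): the table, the steps, the cost calculus
(crux stmt-ValiantsHypothesis-14610 side; docket 8745/8749 of seat val-np-p5)

Three files (`…SeparableCoeffThreeEngine`, `…SeparableCoeffThreeChain`, `…SeparableCoeffThree`) prove:
for every `n ≥ 6` and every table of univariate coefficient sequences `c_l : ℕ → ℂ` (`l < n`)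
there is `Λ ∈ SmallCircuits ℂ n 3` (degree `≤ n`, fan-in-two size `≤ n³`) with
`coeff_μ Λ = ∏_l c_l(μ_l)` for every `|μ| ≤ n` (`separableCoeff_three`). The tree's
`stub_separableCoeff` has the same conclusion at exponent `8` (truncation by interpolation, no
sharing); here the degree-`≤ n` truncation `Λ = Σ_{d ≤ n} (∏_l G_l(x_l))_d`,
`G_l = Σ_{k ≤ n} c_l(k) x_l^k`, is computed by the truncated-product dynamic programme
`P_{i+1,d} = Σ_{k ≤ d} c_i(k) x_i^k P_{i,d-k}` (`P_{i,d}` = degree-`d` part of `∏_{l<i} G_l`), all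
entries sharing ONE circuit via the tree's chain bound `complexity_chain_le` (Bürgisser 2000,
Rem. 2.7). The table — powers `x_l^k`, rows `P_{i,·}` (`i = 1, …, n-1`), prefix sums
`S_j = Σ_{d ≤ j} P_{n-1,d}`, and the output `Λ = Σ_k c_{n-1}(k) x_{n-1}^k S_{n-k}` — is indexed by
the finite linear order `Idx n = Fin 3 ×ₗ (Fin n ×ₗ Fin (n+1))` (block, row, column); its sharp cost
is `n(n-1) + n + (n-2)n² + n + (2n-1) = n³ - n² + 3n - 1` (`(d-1)` products and `d` weighted
additions per middle entry); the files prove the cruder `≤ n³` for `n ≥ 6`.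

THIS FILE holds (1) ALL the proof-device definitions of the three files — the polynomials of the
dynamic programme (`uni`, `piLT`, `P`, `S`, `trunc`), the index order and the table
(`Idx`, `idx`, `cN`, `c0prod`, `tabN`, `tab`), the step polynomials in the inputs and placeholder
variables for earlier entries (`yv`, `xin`, `coefP`, `termP`, `coefT`, `termT`, `stepN`, `step`,
`subst`) and the cost table (`costN`) — none of them a new mathematical notion; and (2) the cost
calculus: a weighted addition `a•f + b•g` is ONE gate of Bürgisser's model (`complexity_wadd_le`;
the tree's `complexity_add_le` is the case `a = b = 1`), weighted sums of `m ≥ 2` terms cost `m - 1`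
gates beyond their terms (`complexity_wsum_le`), and the tree's chain bound transported to any
finite linear order (`complexity_chain_le_linearOrder`).

Honest framing: 14610-side bookkeeping (the cost of FSV's Construction 25 in regime `d = n`);
consumers are the factorial polynomial / principal catalecticant minors at exponent `3` (tree: `8`);
nothing here bears on the open cruxes or on `VP ≠ VNP`.

References: [ForbesShpilkaVolk2018] Construction 25, Fact 26; [Burgisser2000] Def. 2.1, Rem. 2.7.
-/

-- layout Summits/ValiantsHypothesis/ValiantsHypothesis forces the duplicated namespace component
set_option linter.dupNamespace false

noncomputable section

namespace Summit.ValiantsHypothesis.ValiantsHypothesis.Theorems.BarrierLever.SuccinctHittingSetsForVP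

open Literature.Barriers.ValiantsHypothesis Literature.Computability.AlgebraicComplexity MvPolynomial

namespace SeparableCoeffThree

/-! ### The polynomials of the dynamic programme -/

section Objects

variable {n : ℕ} (c : Fin n → ℕ → ℂ)

/-- The univariate factor `G_l = Σ_{k ≤ n} c_l(k) x_l^k`. [cite: ForbesShpilkaVolk2018, Construction 25] -/
def uni (l : Fin n) : MvPolynomial (Fin n) ℂ :=
  ∑ k ∈ Finset.range (n + 1), C (c l k) * X l ^ k

/-- The partial product `Π_{<i} = ∏_{l < i} G_l` over the first `i` variables. [folklore] -/
def piLT (i : ℕ) : MvPolynomial (Fin n) ℂ :=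
  ∏ l ∈ Finset.univ.filter (fun l : Fin n => (l : ℕ) < i), uni c l

/-- The table entry `P_{i,d}` = degree-`d` homogeneous component of `Π_{<i}`. [folklore] -/
def P (i d : ℕ) : MvPolynomial (Fin n) ℂ :=
  homogeneousComponent d (piLT c i)

/-- The prefix sums `S_j = Σ_{d ≤ j} P_{n-1,d}`. [folklore] -/
def S (j : ℕ) : MvPolynomial (Fin n) ℂ :=
  ∑ d ∈ Finset.range (j + 1), P c (n - 1) d

/-- The output `Λ = Σ_{d ≤ n} P_{n,d}` = degree-`≤ n` truncation of `∏_l G_l`. [folklore] -/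
def trunc : MvPolynomial (Fin n) ℂ :=
  ∑ d ∈ Finset.range (n + 1), P c n d

/-! ### The index order, the table, the steps, the costs -/

/-- The index type of the table: (block, row, column), lexicographically ordered. [folklore] -/
abbrev Idx (n : ℕ) : Type := Fin 3 ×ₗ (Fin n ×ₗ Fin (n + 1))

/-- The index `(a, b, e)`. [folklore] -/
def idx (a : Fin 3) (b : Fin n) (e : Fin (n + 1)) : Idx n := toLex (a, toLex (b, e))

/-- Coefficient lookup with a natural-number row index (`0` out of range). [folklore] -/
def cN (b k : ℕ) : ℂ := if h : b < n then c ⟨b, h⟩ k else 0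

/-- The product `∏_{l<i} c_l(0)` of constant terms. [folklore] -/
def c0prod (i : ℕ) : ℂ := ∏ l ∈ Finset.univ.filter (fun l : Fin n => (l : ℕ) < i), c l 0

/-- The TABLE (values), with natural-number indices: block `0` = powers `x_b^e`; block `1`, row `b`
(`b + 2 ≤ n`) = `P_{b+1,e}`; block `2`, row `0` = `S_e`, entry `(2,1,0)` = the output `Λ`; all other
entries `0`. [folklore] -/
def tabN (a b e : ℕ) : MvPolynomial (Fin n) ℂ :=
  if a = 0 then (if h : b < n then X (⟨b, h⟩ : Fin n) ^ e else 0)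
  else if a = 1 then (if b + 2 ≤ n then P c (b + 1) e else 0)
  else (if b = 0 then S c e else if b = 1 ∧ e = 0 then trunc c else 0)

/-- The table as a function on the index order. [folklore] -/
def tab (x : Idx n) : MvPolynomial (Fin n) ℂ :=
  tabN c (ofLex x).1 (ofLex (ofLex x).2).1 (ofLex (ofLex x).2).2

/-- The placeholder variable reading entry `(a, b, e)` (`0` if out of range). [folklore] -/
def yv (a b e : ℕ) : MvPolynomial (Fin n ⊕ Idx n) ℂ :=
  if h : a < 3 ∧ b < n ∧ e < n + 1 then
    X (Sum.inr (idx (⟨a, h.1⟩ : Fin 3) (⟨b, h.2.1⟩ : Fin n) (⟨e, h.2.2⟩ : Fin (n + 1))))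
  else 0

/-- The input variable `x_b` inside step polynomials (`0` if out of range). [folklore] -/
def xin (b : ℕ) : MvPolynomial (Fin n ⊕ Idx n) ℂ :=
  if h : b < n then X (Sum.inl (⟨b, h⟩ : Fin n)) else 0

/-- Coefficients of the weighted sum computing `P_{b+1,e}` (`b ≥ 1`, `e ≥ 1`): `c_b(k)` for `k < e`,
and `c_b(e) · ∏_{l<b} c_l(0)` for the last term (the constant `P_{b,0}` folded in). [folklore] -/
def coefP (b e k : ℕ) : ℂ := if k < e then cN c b k else cN c b e * c0prod c b

/-- Terms of that weighted sum: `Y_{P_{b,e}}`, `Y_{x_b^k} · Y_{P_{b,e-k}}` (`0 < k < e`), `Y_{x_b^e}`.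
[folklore] -/
def termP (b e k : ℕ) : MvPolynomial (Fin n ⊕ Idx n) ℂ :=
  if k = 0 then yv 1 (b - 1) e else if k < e then yv 0 b k * yv 1 (b - 1) (e - k) else yv 0 b e

/-- Coefficients of the weighted sum computing the output `Λ = Σ_k c_{n-1}(k) x_{n-1}^k S_{n-k}`.
[folklore] -/
def coefT (k : ℕ) : ℂ := if k < n then cN c (n - 1) k else cN c (n - 1) n * c0prod c (n - 1)

/-- Terms of that weighted sum: `Y_{S_n}`, `Y_{x_{n-1}^k} · Y_{S_{n-k}}` (`0 < k < n`),
`Y_{x_{n-1}^n}`. [folklore] -/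
def termT (k : ℕ) : MvPolynomial (Fin n ⊕ Idx n) ℂ :=
  if k = 0 then yv 2 0 n else if k < n then yv 0 (n - 1) k * yv 2 0 (n - k) else yv 0 (n - 1) n

/-- The STEP polynomials (each entry as a polynomial in the inputs and the earlier entries).
[folklore] -/
def stepN (a b e : ℕ) : MvPolynomial (Fin n ⊕ Idx n) ℂ :=
  if a = 0 then
    (if e = 0 then 1 else if e = 1 then xin b else xin b * yv 0 b (e - 1))
  else if a = 1 then
    (if b + 2 ≤ n then
      (if b = 0 then (if e = 0 then C (cN c 0 0) else C (cN c 0 e) * yv 0 0 e)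
       else if e = 0 then C (c0prod c (b + 1))
       else ∑ k ∈ Finset.range (e + 1), coefP c b e k • termP b e k)
     else 0)
  else
    (if b = 0 then (if e = 0 then C (c0prod c (n - 1)) else yv 2 0 (e - 1) + yv 1 (n - 2) e)
     else if b = 1 ∧ e = 0 then ∑ k ∈ Finset.range (n + 1), coefT c k • termT k
     else 0)

/-- The steps as a function on the index order. [folklore] -/
def step (x : Idx n) : MvPolynomial (Fin n ⊕ Idx n) ℂ :=
  stepN c (ofLex x).1 (ofLex (ofLex x).2).1 (ofLex (ofLex x).2).2

/-- The substitution of the chain at index `t`: inputs, and the earlier entries. [folklore] -/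
def subst (t : Idx n) : Fin n ⊕ Idx n → MvPolynomial (Fin n) ℂ :=
  Sum.elim X (fun s : Idx n => if s < t then tab c s else 0)

end Objects

/-- The cost table: `[2 ≤ e]` for powers; first row `[e ≥ 1]`, middle rows `2e - 1`, junk `0`;
prefix sums `[e ≥ 1]`, the output `2n - 1`. [folklore] -/
def costN (n a b e : ℕ) : ℕ :=
  if a = 0 then (if 2 ≤ e then 1 else 0)
  else if a = 1 then
    (if b + 2 ≤ n then (if b = 0 then (if e = 0 then 0 else 1) else 2 * e - 1) else 0)
  else (if b = 0 then (if e = 0 then 0 else 1) else if b = 1 ∧ e = 0 then 2 * n - 1 else 0)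

/-! ### Cost calculus: weighted addition is one gate; weighted sums; chains over a linear order -/

section Cost

universe u v

variable {k : Type u} [CommSemiring k] {τ : Type v}

open ArithCircuit in
/-- **Weighted addition costs one gate**: `L(a • f + b • g) ≤ L(f) + L(g) + 1` — a sum gate of
Bürgisser's model carries its coefficients (the tree's `complexity_add_le` is the case `a = b = 1`).
[cite: Burgisser2000, Def. 2.1] -/
theorem complexity_wadd_le (a b : k) (f g : MvPolynomial τ k) :
    complexity (a • f + b • g) ≤ complexity f + complexity g + 1 := by
  obtain ⟨P, hP2, hPc, hPs⟩ := exists_computes_size_eq_complexity f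
  obtain ⟨Q, hQ2, hQc, hQs⟩ := exists_computes_size_eq_complexity g
  -- the circuit: `P`, then `Q` shifted, then one sum gate `a • out(P) + b • out(Q)`
  let R : ArithCircuit k τ :=
    { gates := (P.append Q).gates ++
        [Gate.sum [(a, P.output.truncate P.size), (b, Q.output.shift P.size)]]
      output := Operand.gate (P.size + Q.size) }
  have hR2 : R.IsFanInTwo := by
    intro g' hg'
    simp only [R, List.mem_append, List.mem_singleton] at hg'
    rcases hg' with hg' | rfl
    · exact IsFanInTwo.append hP2 hQ2 g' hg'
    · simp [Gate.fanIn, Gate.args]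
  have hRsize : R.size = P.size + Q.size + 1 := by
    simp [R, ArithCircuit.append, ArithCircuit.size, Nat.add_assoc]
  have hReval : R.eval = a • P.eval + b • Q.eval := by
    have hP := gateValues_length (k := k) P.gates
    have hQ := gateValues_length (k := k) Q.gates
    have h1 := Operand.eval_truncate_append (gateValues P.gates) (gateValues Q.gates) P.output
    have h2 := Operand.eval_shift_append (gateValues P.gates) (gateValues Q.gates) Q.output
    rw [hP] at h1 h2
    simp [R, ArithCircuit.eval, gateValues_append_gates, gateValues_append_singleton, Gate.eval,
      ArithCircuit.size, List.getD_eq_getElem?_getD, hP, hQ, h1, h2]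
  have hRc : R.Computes (a • f + b • g) := by
    rw [Computes] at hPc hQc ⊢
    rw [hReval, hPc, hQc]
  calc complexity (a • f + b • g) ≤ R.size := complexity_le_size hR2 hRc
    _ = complexity f + complexity g + 1 := by rw [hRsize, hPs, hQs]

/-- **Weighted sums**: for `m ≥ 2` terms, `L(Σ_{j<m} a_j • T_j) ≤ Σ_{j<m} L(T_j) + (m - 1)`
(one weighted-addition gate per further term). [cite: Burgisser2000, Def. 2.1] -/
theorem complexity_wsum_le (a : ℕ → k) (T : ℕ → MvPolynomial τ k) :
    ∀ m : ℕ, 2 ≤ m →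
      complexity (∑ j ∈ Finset.range m, a j • T j) ≤
        ∑ j ∈ Finset.range m, complexity (T j) + (m - 1) := by
  intro m hm
  induction m, hm using Nat.le_induction with
  | base =>
    rw [Finset.sum_range_succ, Finset.sum_range_one, Finset.sum_range_succ, Finset.sum_range_one]
    exact complexity_wadd_le _ _ _ _
  | succ m hm ih =>
    rw [Finset.sum_range_succ, Finset.sum_range_succ (fun j => complexity (T j))]
    calc complexity (∑ j ∈ Finset.range m, a j • T j + a m • T m)
        = complexity ((1 : k) • (∑ j ∈ Finset.range m, a j • T j) + a m • T m) := by rw [one_smul]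
      _ ≤ complexity (∑ j ∈ Finset.range m, a j • T j) + complexity (T m) + 1 :=
          complexity_wadd_le _ _ _ _
      _ ≤ (∑ j ∈ Finset.range m, complexity (T j) + (m - 1)) + complexity (T m) + 1 := by
          gcongr
      _ = ∑ j ∈ Finset.range m, complexity (T j) + complexity (T m) + (m + 1 - 1) := by omega

/-- **The chain bound over any finite linear order** (transport of the tree's
`complexity_chain_le` along `monoEquivOfFin`): if `f t = F t (X, (f s)_{s < t}, 0, …)` for all
`t : ι`, then `L(f t) ≤ Σ_s L(F s)`. [cite: Burgisser2000, Rem. 2.7] -/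
theorem complexity_chain_le_linearOrder {ι : Type} [Fintype ι] [LinearOrder ι]
    (f : ι → MvPolynomial τ k) (F : ι → MvPolynomial (τ ⊕ ι) k)
    (hF : ∀ t : ι, f t = aeval (Sum.elim X (fun s : ι => if s < t then f s else 0)) (F t))
    (t : ι) : complexity (f t) ≤ ∑ s : ι, complexity (F s) := by
  classical
  set e : Fin (Fintype.card ι) ≃o ι := monoEquivOfFin ι rfl with he
  let f' : Fin (Fintype.card ι) → MvPolynomial τ k := fun s => f (e s)
  let F' : Fin (Fintype.card ι) → MvPolynomial (τ ⊕ Fin (Fintype.card ι)) k :=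
    fun s => rename (Sum.map id e.symm) (F (e s))
  have hF' : ∀ t', f' t' =
      aeval (Sum.elim X (fun s : Fin (Fintype.card ι) => if s < t' then f' s else 0)) (F' t') := by
    intro t'
    have hfun : ((Sum.elim X fun s : Fin (Fintype.card ι) => if s < t' then f' s else 0) ∘
        Sum.map id ⇑e.symm : τ ⊕ ι → MvPolynomial τ k) =
        Sum.elim X (fun s : ι => if s < e t' then f s else 0) := by
      funext x
      rcases x with x | s
      · rfl
      · simp only [f', Function.comp_apply, Sum.map_inr, Sum.elim_inr, OrderIso.apply_symm_apply]
        by_cases hs : s < e t'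
        · rw [if_pos hs, if_pos (by simpa using (e.symm.lt_iff_lt).2 hs)]
        · rw [if_neg hs, if_neg (fun h => hs (by simpa using (e.lt_iff_lt).2 h))]
    simp only [F', aeval_rename, hfun]
    exact hF (e t')
  have hmain := complexity_chain_le f' F' hF' (e.symm t)
  simp only [f', OrderIso.apply_symm_apply] at hmain
  refine hmain.trans (le_of_eq ?_)
  have hren : ∀ s, complexity (F' s) = complexity (F (e s)) := fun s =>
    complexity_rename_of_injective_holds
      (Sum.map_injective.2 ⟨Function.injective_id, e.symm.injective⟩) _
  simp only [hren]
  exact Fintype.sum_equiv e.toEquiv (fun s => complexity (F (e s))) (fun s => complexity (F s))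
    (fun s => rfl)

end Cost

end SeparableCoeffThree

end Summit.ValiantsHypothesis.ValiantsHypothesis.Theorems.BarrierLever.SuccinctHittingSetsForVP

end
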